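import Summits.QuantumFields.YangMills.Theorems.UV3PinnedTransportStep
import Summits.QuantumFields.YangMills.Theorems.AlphaInputsT3ACv3Lane
import Summits.QuantumFields.Balaban3D.Proofs.Bound55AC
import HarnessLib

/-!
# R3 (cell `ym3-torus`, YM₃ on T³ — a ladder RUNG, NOT d = 4, NOT the Clay problem), UV3-node side of `stub_pinnedStep` (R-19936-S) —
# **THE RESTRICTED TRANSPORT STEP ON THE STANDARD AC TOWER**: one renormalization step (48)–(49) ⇒ (55)·(58) `dV`-a.e. for a density that is
# a.e. majorised by a DOMINATED, RESTRICTED history sum of the lane's (41)_k right-hand side — the lane's residual `Fibre49AC` and mass recursion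
# consumed VERBATIM, the output sum restricted to any finite family of new histories closed under the lane's covering `h ⌢ largeSet(h,U)`

Seat `ym3-torus-px8` g11.  THEOREMS ONLY (0 `def`, 0 `sorry`); `--supports stmt-QuantumFields-19936 --as helper`; count-neutral.  LOCATE
`LOCATE-PINNED41-RESTRICTION-px8g11.md` (19936 evidence #57) §1(b)–(c) = BRICK B, lane-level half: this is `Bound55AC.transport_rho_le_lf_ae`/`bound55_stdAC`
(the lane's C1 assembly) with (i) the input density replaced by ANY non-negative integrable `σ` that is `dU`-a.e. below `Σ_h m₀(h)·e^{(41)_k exponent}`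
for a mass `0 ≤ m₀ ≤ m_k` (the pin: `m₀ = 𝟙_A·m_k` at the pinned level, `m₀ = 𝟙_{H}·m_k` above it), and (ii) the output functional replaced by the
history sum over any `H₁ : Finset (Hist (k+1))` containing the covering history `h ⌢ largeSet(h,U)` of every `(h,U)` with `m₀(h,U) ≠ 0`.  Ingredients:
✓`UV3PinnedTransportStep.transport41_le_sum_ae_of_ac_of_ae_le` (px8 g11 BRICK A), the lane's `Bound55Masses.stepWeight_mul_chiB_cover` (needs the
threshold ordering `εL k ≤ εS k` at this step and admissibility, which `m_k(h,U) ≠ 0` forces: `MassesAC.massRecAC_eq_zero_of_not_admissible`),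
`MassesAC.transport_le_massRecAC_ae` (`hm₁`), and the package's (β) residual `Bound55AC.Fibre49AC` for every new history (`hfibre`, displayed).

WHAT IS PROVED (ns `…Theorems.UV3PinnedRestrictedStep`), at the generality of `Bound55AC` §2–§3 (`X : ExternalInputsAC S G`, `K : CarrierConsts`,
`𝔖`, `slot`, step `k`, pieces `P` over `(stdTowerInputAC X K 𝔖).towerWith slot`):
* §1 ★★★ `transport_restricted_le_sum_ae` — `T_k σ ≤ Σ_{h′ ∈ H₁} m_{k+1}(h′)·exp[(55)·(58) exponent of P at h′]` `dV`-a.e.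
* §2 (the lane's concrete objects `towerOfAC 𝔎 X 𝔖`, `piecesAC`/`piecesWAC`, `inputOfAC`) ★★ `transport_restricted_le_sum41_ae` — the same with the
  exponent UPGRADED to the (41)_{k+1} exponent by the tree's per-history gathering step ✓`AlphaV3AC.expo5558_le_expo41_succ_of_leaves`
  (`AlphaInputsT3ACv3Lane`; twin ✓`RepAtHeightsAdapter.expo5558_le_expo41_succ`) over the lane's `Thm2AC.stepLeavesOfAC` (the nine residual leaves
  `StepResidualsAC` as a hypothesis — the package gives them, `Thm2AC.stepResidualsAC_of_alpha`).  SIBLING: the TRIVIAL-HISTORY restriction of (41)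
  (small-field event, one history) is ✓`UnitScaleTiltFluctuationComparisonRegPrRestrictedUpperStep.upper41_oneStep_triv_ae` (fleet ym-ust-19201, same three
  ingredients `fibre49` + `transport_le_massRecAC_ae` + the exponent step); THIS file restricts to a covering-closed FAMILY (the pin), which needs the cover.
* §3 ★★★ `restricted41_above_of_residualsAC` — THE INDUCTION ABOVE A BASE LEVEL `b`: a sequence `σ_k` with `σ_{k+1} =ᵐ T_k σ_k`, a history family
  `Ha : (k : ℕ) → Finset (Hist k)` closed under the lane's covering from level `b` on, and the restricted (41) at level `b` ⟹ the restricted (41)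
  `σ_k ≤ Σ_{h ∈ Ha k} m_k(h)·exp[(41)_k exponent]` `dV`-a.e. at every `b ≤ k ≤ K`.
* §4 ★★★ `restricted41_succ_of_pin` — THE PIN LEVEL: `σ_s ≤ 𝟙_A·ρ_s` a.e. (`ρ_s` the lane tower's density, (41)_s from the residual leaves) and a level-
  `(s+1)` family containing the covering history of every `(h,U)` with `U ∈ A`, `m_s(h,U) ≠ 0` ⟹ the restricted (41) at level `s+1` — the base of §3.
  The event indicator is spent HERE, pointwise, in the cover (LOCATE §1(b) Stage 1); the output masses are the lane's.
* (sequel file `UV3PinnedRestrictedPin`: the EXPLICIT pinned family «`a ∈ P_s(h)` ∨ collar» and `pinned41_above_of_residualsAC` = §4 + §3 for it.)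

HONEST SCOPE.  Bookkeeping over the lane's transport lemmas; the (β) fibre row is a hypothesis; no bound of [Balaban1985UV3] is proved; S-step ∕ `hlf` ∕
`hP` ∕ `HistoryTailL` (19936) ∕ UV3's inputs NOT proved; nothing continuum ∕ OS ∕ mass-gap ∕ Clay.
References: T. Bałaban, CMP **102** (1985) 255–275 [Balaban1985UV3] ((7)–(8) pp. 257–258, (41) p. 266, (48)–(49) pp. 267–268, (55) p. 269, (58) p. 270).
-/

set_option autoImplicit false

noncomputable section

namespace Summit.QuantumFields.YangMills.Theorems.UV3PinnedRestrictedStep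

open MeasureTheory
open Literature.MathematicalPhysics.QuantumFieldTheory.Balaban1983to89
open Literature.MathematicalPhysics.QuantumFieldTheory.Balaban1983to89.AveragingRT (rnTransport)
open Literature.MathematicalPhysics.QuantumFieldTheory.Balaban1983to89.B10SectAGathering (StepPieces)
open Literature.MathematicalPhysics.QuantumFieldTheory.Balaban1985CMP102
open Literature.MathematicalPhysics.QuantumFieldTheory.Balaban1985CMP102.Setting
open Summit.QuantumFields.Balaban3D.Carriers
open Summit.QuantumFields.Balaban3D.Proofs.Bound55Masses (chiB chiB_nonneg chiB_le_one measurable_chiB measurable_stepWeight largeSet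
  stepWeight_mul_chiB_cover)
open Summit.QuantumFields.Balaban3D.Proofs.MassesAC
open Summit.QuantumFields.Balaban3D.Proofs.TowerAC
open Summit.QuantumFields.Balaban3D.Proofs.SeriesAC
open Summit.QuantumFields.Balaban3D.Proofs.StandardAC
open Summit.QuantumFields.Balaban3D.Proofs.Bound55AC (Fibre49AC)
open Summit.QuantumFields.YangMills.Theorems.UV3PinnedTransportStep (transport41_le_sum_ae_of_ac_of_ae_le)

variable {L : ℕ} {S : Scales L} {G : Type} [GaugeGroup G] [MeasurableSpace G] [HaarData G] [RegularGaugeGroup G]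
  {V : Type} [NormedAddCommGroup V] [NormedSpace ℂ V]
  (X : ExternalInputsAC S G) (K : CarrierConsts) (𝔖 : ∀ k, StepSeries S G V (nblkOf S K k) k) (slot : ℕ → Prop) (k : ℕ)

/-- ★★★ **THE RESTRICTED TRANSPORT STEP ON THE STANDARD AC TOWER.**  Step pieces `P` at step `k`; the threshold ordering `εL k ≤ εS k` (`hLS`);
the (41)_k summands integrable (`hint`, the lane's `Bound55AC.hint_stdAC`); the (β) residual `Fibre49AC` for every new history (`hfibre`, displayed);
a SMALL mass `0 ≤ m₀ ≤ m_k` with integrable summands (`hm₀0`, `hle`, `hint₀`); a finite family `H₁` of new histories containing the lane's covering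
history `h ⌢ largeSet(h,U)` of every `(h,U)` where the small mass lives (`hcoverIn`); and a non-negative integrable density `σ` with
`σ ≤ Σ_h m₀(h)·exp[−mainT_k + Pint_k − E_k + Zterm_k + Rm_k]` `dU`-a.e. (`hσ`).  THEN
`T_k σ ≤ Σ_{h′ ∈ H₁} m_{k+1}(h′)·exp[−mainT_{k+1} − E_k + (log σ₀ + d(𝔤) log g_k)|B*| + log Z_U + P_old + Zterm_k(proj h′) + Rm_k + log Fl]` `dV`-a.e.
(new masses and averaging the lane's: `massRecAC`, `X.av k`).  Proof: BRICK A's dominated a.e. transport step over the subtype `↥H₁` with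
`proj h′ := h′.1.proj`, cover witness `⟨h ⌢ largeSet(h,U), hcoverIn⟩` (admissibility from `m_k(h,U) ≠ 0`), `hm₁ := transport_le_massRecAC_ae`,
`hfibre` verbatim; `Finset.sum_coe_sort`. [cite: Balaban1985UV3, (48)-(49) pp.267-268 + (55) p.269 + (58) p.270] -/
theorem transport_restricted_le_sum_ae (P : StepPieces ((stdTowerInputAC X K 𝔖).towerWith slot).toTowerRun k)
    (hLS : eps1Of S K k ≤ epsSOf S K k)
    (hint : ∀ h : Hist S.P k, Integrable (fun U => (stdTowerInputAC X K 𝔖).W.mass k h U *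
      Real.exp (-(((stdTowerInputAC X K 𝔖).towerWith slot).mainT k h U) + (stdTowerInputAC X K 𝔖).Pint k h U
        - ((stdTowerInputAC X K 𝔖).towerWith slot).Ecst k
        + ((stdTowerInputAC X K 𝔖).towerWith slot).Zterm k h + ((stdTowerInputAC X K 𝔖).towerWith slot).Rm k)) (fieldMeasure S.P k G))
    (hfibre : ∀ h' : Hist S.P (k + 1), Fibre49AC X K 𝔖 slot k P h')
    (m₀ : Hist S.P k → Density S.P k G) (hm₀0 : ∀ h U, 0 ≤ m₀ h U)
    (hle : ∀ h U, m₀ h U ≤ (stdTowerInputAC X K 𝔖).W.mass k h U)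
    (hint₀ : ∀ h : Hist S.P k, Integrable (fun U => m₀ h U *
      Real.exp (-(((stdTowerInputAC X K 𝔖).towerWith slot).mainT k h U) + (stdTowerInputAC X K 𝔖).Pint k h U
        - ((stdTowerInputAC X K 𝔖).towerWith slot).Ecst k
        + ((stdTowerInputAC X K 𝔖).towerWith slot).Zterm k h + ((stdTowerInputAC X K 𝔖).towerWith slot).Rm k)) (fieldMeasure S.P k G))
    (H₁ : Finset (Hist S.P (k + 1)))
    (hcoverIn : ∀ (h : Hist S.P k) (U : GaugeField S.P k G), m₀ h U ≠ 0 →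
      Hist.snoc h (largeSet K.M₁ (rcolOf S K) (eps1Of S K) k h U) ∈ H₁)
    (σ : Density S.P k G) (hσ0 : ∀ U, 0 ≤ σ U) (hσi : Integrable σ (fieldMeasure S.P k G))
    (hσ : σ ≤ᵐ[fieldMeasure S.P k G] fun U => ∑ h : Hist S.P k, m₀ h U *
      Real.exp (-(((stdTowerInputAC X K 𝔖).towerWith slot).mainT k h U) + (stdTowerInputAC X K 𝔖).Pint k h U
        - ((stdTowerInputAC X K 𝔖).towerWith slot).Ecst k
        + ((stdTowerInputAC X K 𝔖).towerWith slot).Zterm k h + ((stdTowerInputAC X K 𝔖).towerWith slot).Rm k)) :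
    rnTransport (X.av k).avg σ ≤ᵐ[fieldMeasure S.P (k + 1) G] fun W =>
      ∑ h' ∈ H₁, (stdTowerInputAC X K 𝔖).W.mass (k + 1) h' W *
        Real.exp (-(((stdTowerInputAC X K 𝔖).towerWith slot).mainT (k + 1) h' W) - ((stdTowerInputAC X K 𝔖).towerWith slot).Ecst k
          + (P.logσ₀ + P.dg * Real.log (S.gk k)) * P.starB h' + P.logZU h' W + P.Pold h' W
          + ((stdTowerInputAC X K 𝔖).towerWith slot).Zterm k (P.proj h') + ((stdTowerInputAC X K 𝔖).towerWith slot).Rm k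
          + P.logFl h' W) := by
  classical
  -- the generic dominated a.e. step over the subtype of `H₁`
  have key := transport41_le_sum_ae_of_ac_of_ae_le (avg := (X.av k).avg) (X.av_ac k)
    (H₀ := Hist S.P k) (H₁ := ↥H₁) (fun h' => h'.1.proj) σ hσi hσ0 m₀ ((stdTowerInputAC X K 𝔖).W.mass k)
    (fun h U => -(((stdTowerInputAC X K 𝔖).towerWith slot).mainT k h U) + (stdTowerInputAC X K 𝔖).Pint k h U
        - ((stdTowerInputAC X K 𝔖).towerWith slot).Ecst k
        + ((stdTowerInputAC X K 𝔖).towerWith slot).Zterm k h + ((stdTowerInputAC X K 𝔖).towerWith slot).Rm k)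
    (fun h' => stepWeight K.M₁ (rcolOf S K) (eps1Of S K) (epsSOf S K) k h'.1)
    (fun h' => chiB K.M₁ (rcolOf S K) (eps1Of S K) k h'.1)
    (fun h' => (stdTowerInputAC X K 𝔖).W.mass (k + 1) h'.1)
    (fun h' W => Real.exp (-(((stdTowerInputAC X K 𝔖).towerWith slot).mainT (k + 1) h'.1 W)
          - ((stdTowerInputAC X K 𝔖).towerWith slot).Ecst k
          + (P.logσ₀ + P.dg * Real.log (S.gk k)) * P.starB h'.1 + P.logZU h'.1 W + P.Pold h'.1 W
          + ((stdTowerInputAC X K 𝔖).towerWith slot).Zterm k (P.proj h'.1) + ((stdTowerInputAC X K 𝔖).towerWith slot).Rm k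
          + P.logFl h'.1 W))
    hσ hint₀ hm₀0 hle hint
    (fun h' => measurable_stepWeight K.M₁ (rcolOf S K) (eps1Of S K) (epsSOf S K) k h'.1)
    (fun h' U => stepWeight_nonneg K.M₁ (rcolOf S K) (eps1Of S K) (epsSOf S K) k h'.1 U)
    (fun h' U => stepWeight_le_one K.M₁ (rcolOf S K) (eps1Of S K) (epsSOf S K) k h'.1 U)
    (fun h' => measurable_chiB K.M₁ (rcolOf S K) (eps1Of S K) k h'.1)
    (fun h' U => chiB_nonneg K.M₁ (rcolOf S K) (eps1Of S K) k h'.1 U)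
    (fun h' U => chiB_le_one K.M₁ (rcolOf S K) (eps1Of S K) k h'.1 U)
    (by
      -- the pinned cover: the lane's covering history of `(h,U)` lies in `H₁` wherever the small mass lives
      intro h U hm
      have hmass : (stdTowerInputAC X K 𝔖).W.mass k h U ≠ 0 := fun h0 =>
        hm (le_antisymm (h0 ▸ hle h U) (hm₀0 h U))
      have hadm : Hist.Admissible K.M₁ (rcolOf S K) k h := by
        by_contra hna
        exact hmass (massRecAC_eq_zero_of_not_admissible K.M₁ (rcolOf S K) (eps1Of S K) (epsSOf S K) X.av k h U hna)
      obtain ⟨hproj, hone⟩ := stepWeight_mul_chiB_cover K.M₁ (rcolOf S K) (eps1Of S K) (epsSOf S K) k hLS h hadm U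
      exact ⟨⟨_, hcoverIn h U hm⟩, hproj, hone⟩)
    (fun h' => transport_le_massRecAC_ae K.M₁ (rcolOf S K) (eps1Of S K) (epsSOf S K) X.av k h'.1)
    (fun _ _ => (Real.exp_pos _).le)
    (fun h' => hfibre h'.1)
  filter_upwards [key] with W hW
  refine hW.trans (le_of_eq ?_)
  exact Finset.sum_coe_sort H₁ (fun h' => (stdTowerInputAC X K 𝔖).W.mass (k + 1) h' W *
        Real.exp (-(((stdTowerInputAC X K 𝔖).towerWith slot).mainT (k + 1) h' W) - ((stdTowerInputAC X K 𝔖).towerWith slot).Ecst k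
          + (P.logσ₀ + P.dg * Real.log (S.gk k)) * P.starB h' + P.logZU h' W + P.Pold h' W
          + ((stdTowerInputAC X K 𝔖).towerWith slot).Zterm k (P.proj h') + ((stdTowerInputAC X K 𝔖).towerWith slot).Rm k
          + P.logFl h' W))

/-! ## §2 The same step at the lane's concrete objects, with the exponent upgraded to (41)_{k+1} -/

section Lane

open Summit.QuantumFields.Balaban3D.Proofs.Inputs
open Summit.QuantumFields.Balaban3D.Proofs.InputsAC
open Summit.QuantumFields.Balaban3D.Proofs.Thm2AC
open Summit.QuantumFields.Balaban3D.Proofs.ScalesArithmetic (gk_pos gk_le_one)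
open Summit.QuantumFields.Balaban3D.Proofs.AlphaBound55 (eps1Of_le_epsSOf)
open Summit.QuantumFields.YangMills.Theorems.AlphaV3AC (expo5558_le_expo41_succ_of_leaves)

variable (𝔎 : LaneConsts L) {X} (𝔖' : ∀ k, StepSeries S G V (nblkOf S 𝔎.carrier k) k)

/-- ★★ **THE RESTRICTED STEP AT THE LANE'S OBJECTS, (41)_{k+1} EXPONENT.**  `𝔎 : LaneConsts`, AC inputs `X`, series `𝔖`; step `k` with `k + 1 ≤ K`
and the coupling window `g²ε₀ ≤ 1`; the nine residual step leaves `StepResidualsAC` (from the (α) package: `Thm2AC.stepResidualsAC_of_alpha`);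
`hint`, `hfibre` as in the lane's `AlphaAdaptersAC.bound55_piecesAC`; small mass `m₀ ≤ m_k`, family `H₁` with the covering closure, density `σ`
a.e. below the `m₀`-restricted (41)_k right-hand side ⟹ `T_k σ ≤ Σ_{h′ ∈ H₁} m_{k+1}(h′)·exp[−mainT_{k+1} + Pint_{k+1} − E_{k+1} + Zterm_{k+1} + Rm_{k+1}]`
`dV`-a.e. (§1, then the per-history exponent step over `Thm2AC.stepLeavesOfAC`). [cite: Balaban1985UV3, (41) p.266 + (48)-(49) pp.267-268 + (55)-(62) pp.269-272] -/
theorem transport_restricted_le_sum41_ae (k : ℕ) (hk : k + 1 ≤ S.K) (hw : S.g ^ 2 * S.ε₀ ≤ 1)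
    (R : StepResidualsAC 𝔎 X 𝔖' k)
    (hint : ∀ h : Hist S.P k, Integrable (fun U => (inputOfAC 𝔎 X 𝔖').W.mass k h U *
      Real.exp (-((towerWAC 𝔎 X 𝔖').mainT k h U) + (inputOfAC 𝔎 X 𝔖').Pint k h U - (towerWAC 𝔎 X 𝔖').Ecst k
        + (towerWAC 𝔎 X 𝔖').Zterm k h + (towerWAC 𝔎 X 𝔖').Rm k)) (fieldMeasure S.P k G))
    (hfibre : ∀ h' : Hist S.P (k + 1), Fibre49AC X 𝔎.carrier 𝔖' (fun _ => True) k (piecesWAC 𝔎 X 𝔖' k) h')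
    (m₀ : Hist S.P k → Density S.P k G) (hm₀0 : ∀ h U, 0 ≤ m₀ h U)
    (hle : ∀ h U, m₀ h U ≤ (inputOfAC 𝔎 X 𝔖').W.mass k h U)
    (hint₀ : ∀ h : Hist S.P k, Integrable (fun U => m₀ h U *
      Real.exp (-((towerWAC 𝔎 X 𝔖').mainT k h U) + (inputOfAC 𝔎 X 𝔖').Pint k h U - (towerWAC 𝔎 X 𝔖').Ecst k
        + (towerWAC 𝔎 X 𝔖').Zterm k h + (towerWAC 𝔎 X 𝔖').Rm k)) (fieldMeasure S.P k G))
    (H₁ : Finset (Hist S.P (k + 1)))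
    (hcoverIn : ∀ (h : Hist S.P k) (U : GaugeField S.P k G), m₀ h U ≠ 0 →
      Hist.snoc h (largeSet 𝔎.carrier.M₁ (rcolOf S 𝔎.carrier) (eps1Of S 𝔎.carrier) k h U) ∈ H₁)
    (σ : Density S.P k G) (hσ0 : ∀ U, 0 ≤ σ U) (hσi : Integrable σ (fieldMeasure S.P k G))
    (hσ : σ ≤ᵐ[fieldMeasure S.P k G] fun U => ∑ h : Hist S.P k, m₀ h U *
      Real.exp (-((towerWAC 𝔎 X 𝔖').mainT k h U) + (inputOfAC 𝔎 X 𝔖').Pint k h U - (towerWAC 𝔎 X 𝔖').Ecst k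
        + (towerWAC 𝔎 X 𝔖').Zterm k h + (towerWAC 𝔎 X 𝔖').Rm k)) :
    rnTransport (X.av k).avg σ ≤ᵐ[fieldMeasure S.P (k + 1) G] fun W =>
      ∑ h' ∈ H₁, (inputOfAC 𝔎 X 𝔖').W.mass (k + 1) h' W *
        Real.exp (-((towerOfAC 𝔎 X 𝔖').mainT (k + 1) h' W) + (towerOfAC 𝔎 X 𝔖').Pint (k + 1) h' W
          - (towerOfAC 𝔎 X 𝔖').Ecst (k + 1) + (towerOfAC 𝔎 X 𝔖').Zterm (k + 1) h' + (towerOfAC 𝔎 X 𝔖').Rm (k + 1)) := by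
  have h55 := transport_restricted_le_sum_ae X 𝔎.carrier 𝔖' (fun _ => True) k (piecesWAC 𝔎 X 𝔖' k)
    (eps1Of_le_epsSOf k 𝔎.carrier 𝔎.F.b₀_nonneg 𝔎.F.p₀_pos.le (by omega)) hint hfibre m₀ hm₀0 hle hint₀ H₁
    hcoverIn σ hσ0 hσi hσ
  have hg : 0 < (towerOfAC 𝔎 X 𝔖').g k := gk_pos S k
  have hg1 : (towerOfAC 𝔎 X 𝔖').g k ≤ 1 := gk_le_one S hw k (by omega)
  -- the per-history gathering step (the tree's `expo5558_le_expo41_succ_of_leaves`) summed over `H₁`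
  set SL := stepLeavesOfAC k hk R with hSL
  have hexp : ∀ (W : GaugeField S.P (k + 1) G),
      ∑ h' ∈ H₁, (inputOfAC 𝔎 X 𝔖').W.mass (k + 1) h' W *
        Real.exp (-((towerOfAC 𝔎 X 𝔖').mainT (k + 1) h' W) - (towerOfAC 𝔎 X 𝔖').Ecst k
          + (SL.P.logσ₀ + SL.P.dg * Real.log ((towerOfAC 𝔎 X 𝔖').g k)) * SL.P.starB h' + SL.P.logZU h' W + SL.P.Pold h' W
          + (towerOfAC 𝔎 X 𝔖').Zterm k (SL.P.proj h') + (towerOfAC 𝔎 X 𝔖').Rm k + SL.P.logFl h' W) ≤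
      ∑ h' ∈ H₁, (inputOfAC 𝔎 X 𝔖').W.mass (k + 1) h' W *
        Real.exp (-((towerOfAC 𝔎 X 𝔖').mainT (k + 1) h' W) + (towerOfAC 𝔎 X 𝔖').Pint (k + 1) h' W
          - (towerOfAC 𝔎 X 𝔖').Ecst (k + 1) + (towerOfAC 𝔎 X 𝔖').Zterm (k + 1) h' + (towerOfAC 𝔎 X 𝔖').Rm (k + 1)) := fun W =>
    Finset.sum_le_sum fun h' _ => mul_le_mul_of_nonneg_left (Real.exp_le_exp.mpr
      (expo5558_le_expo41_succ_of_leaves SL.P hk hg hg1 SL.cumulant58 SL.repr33_60 SL.vacuumWhole SL.decomp35_61 SL.norm35 SL.starCount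
        SL.oldOutside SL.pintSucc SL.estep62 SL.ztermSucc (SL.rmSucc.mono (by have := le_max_left SL.C₁ SL.C₁'; linarith)) h' W))
      ((inputOfAC 𝔎 X 𝔖').W.mass_nonneg (k + 1) h' W)
  filter_upwards [h55] with W hW
  exact hW.trans (hexp W)

/-! ## §3 The induction above a base level -/

/-- ★★★ **THE RESTRICTED (41) PROPAGATES UP THE TOWER.**  Base level `b`; a sequence of densities `σ_k ≥ 0`, integrable, with `σ_{k+1} = T_k σ_k`
`dV`-a.e. (the lane's RN transport over `X.av k`; a.e. so that rescaled and version-changed towers qualify) for `b ≤ k`, `k + 1 ≤ K`; a history family `Ha k : Finset (Hist k)` CLOSED UNDER THE LANE'S COVERING from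
level `b` on (`h ∈ Ha k`, `m_k(h,U) ≠ 0` ⟹ `h ⌢ largeSet(h,U) ∈ Ha (k+1)`); the residual leaves, `hint`, `hfibre` at every step (the (α) package);
and the restricted (41) at level `b`.  THEN for every `b ≤ k ≤ K`: `σ_k ≤ Σ_{h ∈ Ha k} m_k(h)·exp[(41)_k exponent]` `dV`-a.e. — membership in `Ha`
is a function of the HISTORY alone, so each step is §2 with `m₀ := 𝟙[h ∈ Ha k]·m_k(h)`. [cite: Balaban1985UV3, (41) p.266 + (48)-(49) pp.267-268 + Thm 2 p.272] -/
theorem restricted41_above_of_residualsAC (hw : S.g ^ 2 * S.ε₀ ≤ 1)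
    (R : ∀ k, k + 1 ≤ S.K → StepResidualsAC 𝔎 X 𝔖' k)
    (hint : ∀ k, k + 1 ≤ S.K → ∀ h : Hist S.P k, Integrable (fun U => (inputOfAC 𝔎 X 𝔖').W.mass k h U *
      Real.exp (-((towerWAC 𝔎 X 𝔖').mainT k h U) + (inputOfAC 𝔎 X 𝔖').Pint k h U - (towerWAC 𝔎 X 𝔖').Ecst k
        + (towerWAC 𝔎 X 𝔖').Zterm k h + (towerWAC 𝔎 X 𝔖').Rm k)) (fieldMeasure S.P k G))
    (hfibre : ∀ k, k + 1 ≤ S.K → ∀ h' : Hist S.P (k + 1), Fibre49AC X 𝔎.carrier 𝔖' (fun _ => True) k (piecesWAC 𝔎 X 𝔖' k) h')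
    (b : ℕ) (Ha : (k : ℕ) → Finset (Hist S.P k))
    (hHa : ∀ k, b ≤ k → k + 1 ≤ S.K → ∀ h ∈ Ha k, ∀ U : GaugeField S.P k G, (inputOfAC 𝔎 X 𝔖').W.mass k h U ≠ 0 →
      Hist.snoc h (largeSet 𝔎.carrier.M₁ (rcolOf S 𝔎.carrier) (eps1Of S 𝔎.carrier) k h U) ∈ Ha (k + 1))
    (σ : (k : ℕ) → Density S.P k G) (hσ0 : ∀ k U, 0 ≤ σ k U) (hσi : ∀ k, Integrable (σ k) (fieldMeasure S.P k G))
    (hσT : ∀ k, b ≤ k → k + 1 ≤ S.K → σ (k + 1) =ᵐ[fieldMeasure S.P (k + 1) G] rnTransport (X.av k).avg (σ k))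
    (hbase : σ b ≤ᵐ[fieldMeasure S.P b G] fun W => ∑ h ∈ Ha b, (inputOfAC 𝔎 X 𝔖').W.mass b h W *
      Real.exp (-((towerOfAC 𝔎 X 𝔖').mainT b h W) + (towerOfAC 𝔎 X 𝔖').Pint b h W
        - (towerOfAC 𝔎 X 𝔖').Ecst b + (towerOfAC 𝔎 X 𝔖').Zterm b h + (towerOfAC 𝔎 X 𝔖').Rm b)) :
    ∀ k, b ≤ k → k ≤ S.K → σ k ≤ᵐ[fieldMeasure S.P k G] fun W => ∑ h ∈ Ha k, (inputOfAC 𝔎 X 𝔖').W.mass k h W *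
      Real.exp (-((towerOfAC 𝔎 X 𝔖').mainT k h W) + (towerOfAC 𝔎 X 𝔖').Pint k h W
        - (towerOfAC 𝔎 X 𝔖').Ecst k + (towerOfAC 𝔎 X 𝔖').Zterm k h + (towerOfAC 𝔎 X 𝔖').Rm k) := by
  classical
  intro k hbk hkK
  induction k, hbk using Nat.le_induction with
  | base => exact hbase
  | succ k hbk ih =>
    have hk : k + 1 ≤ S.K := hkK
    have ih' := ih (by omega)
    -- the small mass: the lane's mass restricted to `Ha k` (a function of the history alone)
    set m₀ : Hist S.P k → Density S.P k G := fun h U => if h ∈ Ha k then (inputOfAC 𝔎 X 𝔖').W.mass k h U else 0 with hm₀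
    have hm₀0 : ∀ h U, 0 ≤ m₀ h U := fun h U => by
      simp only [hm₀]; split_ifs
      · exact (inputOfAC 𝔎 X 𝔖').W.mass_nonneg k h U
      · exact le_rfl
    have hle : ∀ h U, m₀ h U ≤ (inputOfAC 𝔎 X 𝔖').W.mass k h U := fun h U => by
      simp only [hm₀]; split_ifs
      · exact le_rfl
      · exact (inputOfAC 𝔎 X 𝔖').W.mass_nonneg k h U
    have hint₀ : ∀ h : Hist S.P k, Integrable (fun U => m₀ h U *
        Real.exp (-((towerWAC 𝔎 X 𝔖').mainT k h U) + (inputOfAC 𝔎 X 𝔖').Pint k h U - (towerWAC 𝔎 X 𝔖').Ecst k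
          + (towerWAC 𝔎 X 𝔖').Zterm k h + (towerWAC 𝔎 X 𝔖').Rm k)) (fieldMeasure S.P k G) := fun h => by
      by_cases hh : h ∈ Ha k
      · simp only [hm₀, if_pos hh]; exact hint k hk h
      · simp only [hm₀, if_neg hh, zero_mul]; exact integrable_const 0
    have hcoverIn : ∀ (h : Hist S.P k) (U : GaugeField S.P k G), m₀ h U ≠ 0 →
        Hist.snoc h (largeSet 𝔎.carrier.M₁ (rcolOf S 𝔎.carrier) (eps1Of S 𝔎.carrier) k h U) ∈ Ha (k + 1) := fun h U hm => by
      by_cases hh : h ∈ Ha k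
      · simp only [hm₀, if_pos hh] at hm
        exact hHa k hbk hk h hh U hm
      · simp only [hm₀, if_neg hh] at hm
        exact absurd rfl hm
    -- the induction hypothesis in the `m₀` currency (same exponent: `pin` changes only `ρ`)
    have hσ : σ k ≤ᵐ[fieldMeasure S.P k G] fun U => ∑ h : Hist S.P k, m₀ h U *
        Real.exp (-((towerWAC 𝔎 X 𝔖').mainT k h U) + (inputOfAC 𝔎 X 𝔖').Pint k h U - (towerWAC 𝔎 X 𝔖').Ecst k
          + (towerWAC 𝔎 X 𝔖').Zterm k h + (towerWAC 𝔎 X 𝔖').Rm k) := by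
      filter_upwards [ih'] with U hU
      refine hU.trans (le_of_eq ?_)
      rw [← Finset.sum_filter_add_sum_filter_not Finset.univ (fun h => h ∈ Ha k)]
      have h1 : ∑ h ∈ Finset.univ.filter (fun h => h ∈ Ha k), m₀ h U *
          Real.exp (-((towerWAC 𝔎 X 𝔖').mainT k h U) + (inputOfAC 𝔎 X 𝔖').Pint k h U - (towerWAC 𝔎 X 𝔖').Ecst k
            + (towerWAC 𝔎 X 𝔖').Zterm k h + (towerWAC 𝔎 X 𝔖').Rm k)
          = ∑ h ∈ Ha k, (inputOfAC 𝔎 X 𝔖').W.mass k h U *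
          Real.exp (-((towerOfAC 𝔎 X 𝔖').mainT k h U) + (towerOfAC 𝔎 X 𝔖').Pint k h U
            - (towerOfAC 𝔎 X 𝔖').Ecst k + (towerOfAC 𝔎 X 𝔖').Zterm k h + (towerOfAC 𝔎 X 𝔖').Rm k) := by
        have hset : Finset.univ.filter (fun h => h ∈ Ha k) = Ha k := by
          ext h; simp
        rw [hset]
        refine Finset.sum_congr rfl fun h hh => ?_
        simp only [hm₀, if_pos hh]
        rfl
      have h2 : ∑ h ∈ Finset.univ.filter (fun h => ¬ h ∈ Ha k), m₀ h U *
          Real.exp (-((towerWAC 𝔎 X 𝔖').mainT k h U) + (inputOfAC 𝔎 X 𝔖').Pint k h U - (towerWAC 𝔎 X 𝔖').Ecst k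
            + (towerWAC 𝔎 X 𝔖').Zterm k h + (towerWAC 𝔎 X 𝔖').Rm k) = 0 := by
        refine Finset.sum_eq_zero fun h hh => ?_
        rw [Finset.mem_filter] at hh
        simp only [hm₀, if_neg hh.2, zero_mul]
      rw [h1, h2, add_zero]
    have step := transport_restricted_le_sum41_ae 𝔎 𝔖' k hk hw (R k hk) (hint k hk) (hfibre k hk) m₀ hm₀0 hle hint₀ (Ha (k + 1))
      hcoverIn (σ k) (hσ0 k) (hσi k) hσ
    filter_upwards [hσT k hbk hk, step] with W hW hs
    rw [hW]
    exact hs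

/-! ## §4 The pin level: the event indicator spent in the cover -/

/-- ★★★ **THE PIN LEVEL `s → s+1`.**  Pinned level `s` with `s + 1 ≤ K`, window `g²ε₀ ≤ 1`; the residual leaves for EVERY step `≤ s` (they give
(41)_s for the lane tower, `Thm2AC.ineq41_47_of_residualsAC`) and `hint`/`hfibre` at step `s`; a measurable event `A` of level-`s` fields (the pin:
«plaquette `a` large at threshold `θ`»); a non-negative integrable `σ` with `σ ≤ 𝟙_A·ρ_s` `dU`-a.e. (`ρ_s` the lane tower's density — the cell's
restricted tower after undoing the `e^{E}` normalisation, by monotonicity of the transports below the pin); and a level-`(s+1)` history family `H₁`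
containing the lane's covering history `h ⌢ largeSet(h,U)` for every `U ∈ A` with `m_s(h,U) ≠ 0` (for the pin this is ✓`UV3PinnedTransportStep.
mem_last_snoc_largeSet_of_le`: `εL s ≤ θ` and `plaqCover a ⊆ Ω_s(h)` put `a` in that history's newborn large-field set; the collar branch takes the
rest).  THEN `T_s σ ≤ Σ_{h′ ∈ H₁} m_{s+1}(h′)·exp[(41)_{s+1} exponent]` `dV`-a.e. — the base of §3.  The indicator is spent pointwise choosing the
covering histories; `Fibre49AC` and the masses are the lane's, at the lane's thresholds (LOCATE §1(b), and the reason for its (F2)).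
[cite: Balaban1985UV3, (7)-(8) pp.257-258 + (41) p.266 + (48)-(49) pp.267-268] -/
theorem restricted41_succ_of_pin (s : ℕ) (hs : s + 1 ≤ S.K) (hw : S.g ^ 2 * S.ε₀ ≤ 1)
    (R : ∀ k, k + 1 ≤ S.K → StepResidualsAC 𝔎 X 𝔖' k)
    (hint : ∀ h : Hist S.P s, Integrable (fun U => (inputOfAC 𝔎 X 𝔖').W.mass s h U *
      Real.exp (-((towerWAC 𝔎 X 𝔖').mainT s h U) + (inputOfAC 𝔎 X 𝔖').Pint s h U - (towerWAC 𝔎 X 𝔖').Ecst s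
        + (towerWAC 𝔎 X 𝔖').Zterm s h + (towerWAC 𝔎 X 𝔖').Rm s)) (fieldMeasure S.P s G))
    (hfibre : ∀ h' : Hist S.P (s + 1), Fibre49AC X 𝔎.carrier 𝔖' (fun _ => True) s (piecesWAC 𝔎 X 𝔖' s) h')
    (A : Set (GaugeField S.P s G)) (hA : MeasurableSet A)
    (H₁ : Finset (Hist S.P (s + 1)))
    (hcoverIn : ∀ (h : Hist S.P s) (U : GaugeField S.P s G), U ∈ A → (inputOfAC 𝔎 X 𝔖').W.mass s h U ≠ 0 →
      Hist.snoc h (largeSet 𝔎.carrier.M₁ (rcolOf S 𝔎.carrier) (eps1Of S 𝔎.carrier) s h U) ∈ H₁)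
    (σ : Density S.P s G) (hσ0 : ∀ U, 0 ≤ σ U) (hσi : Integrable σ (fieldMeasure S.P s G))
    (hσ : σ ≤ᵐ[fieldMeasure S.P s G] fun U => A.indicator (fun _ => (1 : ℝ)) U * (towerOfAC 𝔎 X 𝔖').ρ s U) :
    rnTransport (X.av s).avg σ ≤ᵐ[fieldMeasure S.P (s + 1) G] fun W =>
      ∑ h' ∈ H₁, (inputOfAC 𝔎 X 𝔖').W.mass (s + 1) h' W *
        Real.exp (-((towerOfAC 𝔎 X 𝔖').mainT (s + 1) h' W) + (towerOfAC 𝔎 X 𝔖').Pint (s + 1) h' W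
          - (towerOfAC 𝔎 X 𝔖').Ecst (s + 1) + (towerOfAC 𝔎 X 𝔖').Zterm (s + 1) h' + (towerOfAC 𝔎 X 𝔖').Rm (s + 1)) := by
  classical
  -- (41)_s for the lane tower, pointwise, in the sum form
  have h41 : B10.Ineq41 (towerOfAC 𝔎 X 𝔖') s := (ineq41_47_of_residualsAC 𝔎 X 𝔖' R s (by omega)).1
  have h41' : ∀ U : GaugeField S.P s G, (towerOfAC 𝔎 X 𝔖').ρ s U ≤ ∑ h : Hist S.P s, (inputOfAC 𝔎 X 𝔖').W.mass s h U *
      Real.exp (-((towerWAC 𝔎 X 𝔖').mainT s h U) + (inputOfAC 𝔎 X 𝔖').Pint s h U - (towerWAC 𝔎 X 𝔖').Ecst s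
        + (towerWAC 𝔎 X 𝔖').Zterm s h + (towerWAC 𝔎 X 𝔖').Rm s) := fun U => h41 U
  -- the small mass `𝟙_A · m_s`
  set m₀ : Hist S.P s → Density S.P s G := fun h U => A.indicator (fun _ => (1 : ℝ)) U * (inputOfAC 𝔎 X 𝔖').W.mass s h U with hm₀
  have hind01 : ∀ U, 0 ≤ A.indicator (fun _ => (1 : ℝ)) U ∧ A.indicator (fun _ => (1 : ℝ)) U ≤ 1 := fun U => by
    by_cases hU : U ∈ A
    · rw [Set.indicator_of_mem hU]; exact ⟨zero_le_one, le_rfl⟩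
    · rw [Set.indicator_of_notMem hU]; exact ⟨le_rfl, zero_le_one⟩
  have hm₀0 : ∀ h U, 0 ≤ m₀ h U := fun h U => mul_nonneg (hind01 U).1 ((inputOfAC 𝔎 X 𝔖').W.mass_nonneg s h U)
  have hle : ∀ h U, m₀ h U ≤ (inputOfAC 𝔎 X 𝔖').W.mass s h U := fun h U => by
    calc m₀ h U ≤ 1 * (inputOfAC 𝔎 X 𝔖').W.mass s h U :=
          mul_le_mul_of_nonneg_right (hind01 U).2 ((inputOfAC 𝔎 X 𝔖').W.mass_nonneg s h U)
      _ = _ := one_mul _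
  have hint₀ : ∀ h : Hist S.P s, Integrable (fun U => m₀ h U *
      Real.exp (-((towerWAC 𝔎 X 𝔖').mainT s h U) + (inputOfAC 𝔎 X 𝔖').Pint s h U - (towerWAC 𝔎 X 𝔖').Ecst s
        + (towerWAC 𝔎 X 𝔖').Zterm s h + (towerWAC 𝔎 X 𝔖').Rm s)) (fieldMeasure S.P s G) := fun h => by
    have hI := (hint h).indicator hA
    refine hI.congr (Filter.Eventually.of_forall fun U => ?_)
    by_cases hU : U ∈ A
    · simp only [Set.indicator_of_mem hU, hm₀, one_mul]
    · simp only [Set.indicator_of_notMem hU, hm₀, zero_mul]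
  have hcover' : ∀ (h : Hist S.P s) (U : GaugeField S.P s G), m₀ h U ≠ 0 →
      Hist.snoc h (largeSet 𝔎.carrier.M₁ (rcolOf S 𝔎.carrier) (eps1Of S 𝔎.carrier) s h U) ∈ H₁ := fun h U hm => by
    by_cases hU : U ∈ A
    · refine hcoverIn h U hU fun h0 => hm ?_
      simp only [hm₀, h0, mul_zero]
    · exact absurd (by simp only [hm₀, Set.indicator_of_notMem hU, zero_mul]) hm
  -- `σ ≤ 𝟙_A ρ_s ≤ Σ_h 𝟙_A m_s(h) e^{F}` a.e.
  have hσ' : σ ≤ᵐ[fieldMeasure S.P s G] fun U => ∑ h : Hist S.P s, m₀ h U *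
      Real.exp (-((towerWAC 𝔎 X 𝔖').mainT s h U) + (inputOfAC 𝔎 X 𝔖').Pint s h U - (towerWAC 𝔎 X 𝔖').Ecst s
        + (towerWAC 𝔎 X 𝔖').Zterm s h + (towerWAC 𝔎 X 𝔖').Rm s) := by
    filter_upwards [hσ] with U hU
    refine hU.trans ?_
    have hsum : (∑ h : Hist S.P s, m₀ h U *
        Real.exp (-((towerWAC 𝔎 X 𝔖').mainT s h U) + (inputOfAC 𝔎 X 𝔖').Pint s h U - (towerWAC 𝔎 X 𝔖').Ecst s
          + (towerWAC 𝔎 X 𝔖').Zterm s h + (towerWAC 𝔎 X 𝔖').Rm s))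
        = A.indicator (fun _ => (1 : ℝ)) U * ∑ h : Hist S.P s, (inputOfAC 𝔎 X 𝔖').W.mass s h U *
        Real.exp (-((towerWAC 𝔎 X 𝔖').mainT s h U) + (inputOfAC 𝔎 X 𝔖').Pint s h U - (towerWAC 𝔎 X 𝔖').Ecst s
          + (towerWAC 𝔎 X 𝔖').Zterm s h + (towerWAC 𝔎 X 𝔖').Rm s) := by
      rw [Finset.mul_sum]
      refine Finset.sum_congr rfl fun h _ => ?_
      simp only [hm₀]
      ring
    rw [hsum]
    exact mul_le_mul_of_nonneg_left (h41' U) (hind01 U).1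
  exact transport_restricted_le_sum41_ae 𝔎 𝔖' s hs hw (R s hs) hint hfibre m₀ hm₀0 hle hint₀ H₁ hcover' σ hσ0 hσi hσ'

end Lane

end Summit.QuantumFields.YangMills.Theorems.UV3PinnedRestrictedStep

end
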